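import Literature.AnabelianGeometry.EtaleTheta.ArithThetaTowerCor38ii
import Literature.AnabelianGeometry.EtaleTheta.ArithThetaTowerNonDilating
import HarnessLib

/-!
# [EtTh] Cor. 3.8 (ii) at the ARITHMETIC theta tower over `𝒟_v̲ = CosetCat Π_v̲`: the one-call with `hnd` THREADED
# through GA-08's `isNonDilating_of_carrierSpec hC hD` (GAP A item GA-14, wave 2)

S. Mochizuki, *The étale theta function and its Frobenioid-theoretic manifestations*, Publ. RIMS **45** (2009)
[MochizukiEtTh2009], Cor. 3.8 (ii) PDF pp. 80–81 [cite: MochizukiEtTh2009, Cor 3.8 p.81]; *Inter-universal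
Teichmüller theory I*, Example 3.2 (iii) p. 71 ("`𝒞_v ⊆ ℱ̲_v` … may be reconstructed category-theoretically from `ℱ̲_v`
[cf. [EtTh], Corollary 3.8, (ii)]").

GAP A of record G-L5-EX32I-1 (abc-iut cell), item GA-14 (D8 part 2), second file (PROOF-ONLY sequel of
`ArithThetaTowerCor38ii.lean` ★ p670391; RULINGS #339 (3) / chair l.121358: «§5 D8 READS `(hC : CarrierSpec d T C)
(hD : CarrierSpec.PullDichotomy C)`; GA-14's closer passes `hD` BY NAME»; GAP-A-SIGNATURES.md v1 e3ccddf9b87597cf §5).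
With GA-04's add-on `CarrierSpec.PullDichotomy` (`ArithThetaTowerFrobenioidPull.lean` ★ p670531) and GA-08's
`isNonDilating_of_carrierSpec hC hD` (`ArithThetaTowerNonDilating.lean` ★ p671252) in the tree, the `hnd` binder of
`hull_selfEquivalence_of_carrierSpec` is DISCHARGED BY NAME — the H+ branch of RULINGS #319/#339 (2) at the binders:

* `hull_selfEquivalence_of_carrierSpec_of_pullDichotomy` — [EtTh] Cor. 3.8 (ii) for every self-equivalence `e` of a
  tempered Frobenioid `C` over `𝒟_v̲` satisfying S0 AND the pull-back dichotomy: `e` preserves the base-field-theoretic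
  morphisms and lifts to a compatible self-equivalence of the REAL hull `C^{bs-fld}` (the `ReconstructibleAlong C.hull`
  clause [IUTchI] Ex. 3.2 (iii) quotes), modulo `hds` (Div-slimness), `hF` (GA-05's result type; names of record
  `isFrobenioid_of_baseInj C hB` / `isFrobenioid_realifiedOf`, RULINGS #342) and the three `T'`-level print clauses
  `hP34Λ` (Prop. 3.4 (ii) at `Λ`), `hZQ` (Rmk. 3.3.1), `hFinv` (`F₀^Λ` a group);
* `hull_selfEquivalence_of_carrierSpec_of_pullDichotomy_of_isSlimGroup` — the same with `hds` DISCHARGED from `Π_v̲`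
  tempered and slim (★ p511706 `BadLocalFrobenioid.divSlim_cosetCat_of_isSlimGroup` BY NAME): [EtTh] Cor. 3.8 (ii) at
  `C` modulo `hF` and the three `T'`-level clauses ONLY.

HONEST FRAMING: refereed pre-IUT material ([EtTh] §3) instantiated at OUR typed objects; composition BY NAME only
(0 definitions, 0 instances, 0 notation, 0 `sorry`); `hD` at the carrier is GA-12's `pullDichotomy_temperedFrobenioid`,
not inhabited here; an UNDISPUTED construction step around [IUTchIII] Cor. 3.12, which stays OPEN by charter (D-0045) —
no side is taken on it or on any author; typed ≠ inhabited ≠ proved-in-print; nothing here asserts the abc conjecture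
proved or refuted; count-neutral; rq128 untouched.
-/

noncomputable section

namespace Literature.AnabelianGeometry.EtaleTheta

namespace ArithThetaTower

open CategoryTheory Opposite Function Literature.AlgebraicGeometry.Frobenioids Literature.AnabelianGeometry.SemiGraphs
  Literature.IUT.HodgeTheaters

variable {p : ℕ} [Fact p.Prime] {d : GaloisValDatum.{0} p} {P : Type} [Group P] [TopologicalSpace P]
  {T : BadLocalGroupDatum d.Gal P}
  {T' : RealifiedDivisorMonoids (D₀ := T.Dv) treeMonoidVocabWeak.{0}} {VD : FrdICatStub.{0, 0, 0} T.Dv}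
  {C : TemperedFrobenioid T' T.Dv VD}

/-- **[EtTh] Cor. 3.8 (ii) for every SELF-equivalence of a tempered Frobenioid `C` over `𝒟_v̲ = CosetCat Π_v̲`
satisfying the decoupling spec S0 and the pull-back dichotomy** (§5 D8 as ruled, #339 (3): binders `(hC) (hD)`):
`e` preserves the base-field-theoretic morphisms AND lifts to a self-equivalence `e'` of the REAL hull category
`C^{bs-fld}` with `hull ⋙ e ≅ e' ⋙ hull` — `hull_selfEquivalence_of_carrierSpec` with `hnd :=` GA-08's
`isNonDilating_of_carrierSpec hC hD` BY NAME (H+ at every object, no finite-index hypothesis); modulo `hds`, `hF`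
(GA-05's result type) and the three `T'`-level print clauses `hP34Λ`, `hZQ`, `hFinv`. [cite: MochizukiEtTh2009, Cor 3.8 p.81] -/
theorem hull_selfEquivalence_of_carrierSpec_of_pullDichotomy [IsTopologicalGroup P] (hC : CarrierSpec d T C)
    (hD : CarrierSpec.PullDichotomy C)
    (hds : ∀ (A : T.Dv) (α : Aut (Over.forget A)),
      (∀ (B : Over A) (x : C.divisorMonoid.obj (op B.left)),
        Literature.AlgebraicGeometry.Frobenioids.pull C.divisorMonoid (α.hom.app B) x = x) → α = 1)
    (hF : PreFrobenioid.IsFrobenioid C.toElem)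
    (hP34Λ : ∀ (Y : T.Dvᵒᵖ) (b : T'.BΛ.obj Y) (r : T'.ΦR.obj Y),
      T'.divΛ Y b = Algebra.GrothendieckGroup.of r → b ∈ T'.FΛ Y)
    (hZQ : ∀ (Y : T.Dvᵒᵖ) (𝔭 : Primes (T'.Φ₀.obj Y)), IsZMonoprime ↥𝔭.submonoid ∨ IsQMonoprime ↥𝔭.submonoid)
    (hFinv : ∀ (Y : T.Dvᵒᵖ) (b : T'.BΛ.obj Y), b ∈ T'.FΛ Y → ∃ b' ∈ T'.FΛ Y, b' * b = 1)
    (e : C.category ≌ C.category) :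
    (∀ {A B : C.category} (f : A ⟶ B), C.IsBaseFieldTheoretic f ↔ C.IsBaseFieldTheoretic (e.functor.map f)) ∧
      ∃ e' : C.hullCategory ≌ C.hullCategory, Nonempty (C.hull ⋙ e.functor ≅ e'.functor ⋙ C.hull) :=
  hull_selfEquivalence_of_carrierSpec hC (isNonDilating_of_carrierSpec hC hD) hds hF hP34Λ hZQ hFinv e

/-- **The same with `hds` DISCHARGED from `Π_v̲` tempered and slim** (★ p511706
`BadLocalFrobenioid.divSlim_cosetCat_of_isSlimGroup` BY NAME): [EtTh] Cor. 3.8 (ii) for every self-equivalence of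
`C`, given S0 and the pull-back dichotomy, modulo `hF` (GA-05's result type) and the three `T'`-level print clauses
`hP34Λ`, `hZQ`, `hFinv` ONLY. [cite: MochizukiEtTh2009, Cor 3.8 p.81] -/
theorem hull_selfEquivalence_of_carrierSpec_of_pullDichotomy_of_isSlimGroup [IsTopologicalGroup P]
    (hC : CarrierSpec d T C) (hD : CarrierSpec.PullDichotomy C) (hP : IsTempered P) (hZ : IsSlimGroup P)
    (hF : PreFrobenioid.IsFrobenioid C.toElem)
    (hP34Λ : ∀ (Y : T.Dvᵒᵖ) (b : T'.BΛ.obj Y) (r : T'.ΦR.obj Y),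
      T'.divΛ Y b = Algebra.GrothendieckGroup.of r → b ∈ T'.FΛ Y)
    (hZQ : ∀ (Y : T.Dvᵒᵖ) (𝔭 : Primes (T'.Φ₀.obj Y)), IsZMonoprime ↥𝔭.submonoid ∨ IsQMonoprime ↥𝔭.submonoid)
    (hFinv : ∀ (Y : T.Dvᵒᵖ) (b : T'.BΛ.obj Y), b ∈ T'.FΛ Y → ∃ b' ∈ T'.FΛ Y, b' * b = 1)
    (e : C.category ≌ C.category) :
    (∀ {A B : C.category} (f : A ⟶ B), C.IsBaseFieldTheoretic f ↔ C.IsBaseFieldTheoretic (e.functor.map f)) ∧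
      ∃ e' : C.hullCategory ≌ C.hullCategory, Nonempty (C.hull ⋙ e.functor ≅ e'.functor ⋙ C.hull) :=
  hull_selfEquivalence_of_carrierSpec_of_isSlimGroup hC hP hZ (isNonDilating_of_carrierSpec hC hD) hF hP34Λ hZQ
    hFinv e

end ArithThetaTower

end Literature.AnabelianGeometry.EtaleTheta

end
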